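import Summits.AtomisticToContinuum.BoseEinsteinCondensation.Theorems.SoloInformedJeffreysBounds
import Summits.AtomisticToContinuum.BoseEinsteinCondensation.Theorems.SoloInformedJastrowMeanJeffreys

/-!
# Entropic condensation criteria (finite configuration space)

Soloist report `solo-AtomisticToContinuum-informed`, `paper/sharpest.md` §3 (Theorem A, finite
form) and §4.2 (the functionals `I ≤ T`).

Let `T` be a finite one-particle space and `Ψ` an `(n+1)`-particle function on `T^{n+1}` with
positive slices `Ψ(x,Y)` (`x` the first particle, `Y` the other `n`). Write `Z = ∑_X Ψ(X)²`,
`S_Y = ∑ₓ Ψ(x,Y)²`, `P(Y) = S_Y / Z` (law of the environment), `p_Y = Ψ(·,Y)² / S_Y`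
(conditional law of the first particle) and `η = ∑_Y Ψ(·,Y)² / Z` (its marginal, the
one-particle density). For a mode `φ > 0` with `∑ φ² = 1` the occupation in the one-particle
density matrix of a symmetric `Ψ` is `⟨φ, γ_Ψ φ⟩ = N ∑_Y (∑ₓ φ(x) Ψ(x,Y))² / Z`, `N = n + 1`.
The **entropic Penrose–Onsager bounds** kernel-checked here (sums instead of integrals; the
continuum versions differ by routine measure theory; symmetry of `Ψ` is not used by the
inequalities themselves, only by the reading of the right-hand side as an occupation):

* `SoloInformed.occupation_ge_exp_neg_meanKL` — for every positive reference mode `φ`,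
  `∑_Y (∑ₓ φΨ)² / Z ≥ exp(-E_P KL(p_Y ‖ φ²))` (Jensen in `x`, then Jensen in `Y`);
* `SoloInformed.sqrtDensity_occupation_ge_exp_neg_mutualInfo` — the optimal reference is
  `φ² = η`, for which `E_P KL(p_Y ‖ η) = I(X₀ ; X̂)` is the MUTUAL INFORMATION between one
  particle and the others under the classical law `Ψ²/Z` [cite: CoverThomas2005, §2.3–2.4]:
  `⟨√η, γ_Ψ √η⟩ / N ≥ e^{-I(X₀ ; X̂)}`;
* `SoloInformed.sqrtDensity_occupation_ge_of_sum_jeffreys_le` — the symmetrised form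
  `⟨√η, γ_Ψ √η⟩ / N ≥ exp(-½ E_P J(η, p_Y))` with `J = KL(η‖p) + KL(p‖η)` the Jeffreys
  divergence (the abstract statement behind `SoloInformed.sqrtDensity_occupation_ge_of_posDef`);
* `SoloInformed.sum_kl_le_sum_jeffreys` — `I(X₀;X̂) ≤ E_P J(η,p_Y)` (Gibbs' inequality: the
  difference is `E_P KL(η ‖ p_Y) ≥ 0`). In the normalisation-free form used throughout,
  `Z · E_P J(η,p_Y) = ∑_Y ∑ₓ (η(x) S_Y - Ψ(x,Y)²)(-log Ψ(x,Y)²) = Z · T[W]`,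
  `T[W] = E_P (E_η - E_{p_Y}) W_Y`, `W_Y = -log Ψ(·,Y)²`: the "teleportation functional" of the
  report (§4.2). So `fraction ≥ max(e^{-I}, e^{-T/2})` and `I ≤ T`.

Reading (report §0, §5). Ground-state BEC at density `ρ` with condensate fraction `≥ e^{-I*}`
follows from a bound `I(X₀ ; X̂) ≤ I*` on the particle/environment mutual information of
`|Ψ₀|²`, uniformly in `N`; equivalently from CONDITIONAL DELOCALISATION of one particle given
the others at the scale of the box, since `I = min_φ E_P KL(p_Y ‖ φ²) ≤ E_P KL(p_Y ‖ unif)`.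
The bound has the right order at both ends: `Ψ = ∏ h` gives `I = 0` (complete condensation in
`h/‖h‖`), a crystal-like `Ψ` with `p_Y` confined to a cell of volume `v` gives `I ≈ log(V/v)`
and fraction `≈ v/V` (cf. `SoloInformed.not_hasGroundStateBEC_of_confined`). Energy estimates
deliver delocalisation of `p_Y` up to the healing length only (§5 of the report); the missing
input for the interacting ground state is delocalisation beyond it — equivalently, control of
the non-pair part of `W_Y` in `T[W]`.

Status: criteria (doors), not a proof of `Summit.AtomisticToContinuum.BoseEinsteinCondensation`.
Cf. [cite: PenroseOnsager1956, §4–5], [cite: LSSY2005, §1.2 (1.19)].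
-/

noncomputable section

open Finset

namespace Summit.AtomisticToContinuum.BoseEinsteinCondensation.Theorems

section Slice

variable {ι : Type*}

/-- **One-sided slice inequality** (Jensen / weighted AM–GM): for positive vectors `φ, g` on a
nonempty `s`, with `S = ∑ gᵢ²` and `p = g²/S`,
`S · exp(∑ pᵢ (log(φᵢ² S) - log gᵢ²)) = S · exp(∑ pᵢ log(φᵢ²/pᵢ)) ≤ (∑ φᵢ gᵢ)²`; for `∑ φ² = 1`
this is `(∑ φᵢ gᵢ)² ≥ S · e^{-KL(p ‖ φ²)}`. Normalisation-free form. [folklore] -/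
theorem SoloInformed.mul_exp_sum_log_le_sq_sum_mul (s : Finset ι) (hs : s.Nonempty)
    (φ g : ι → ℝ) (hφ : ∀ i ∈ s, 0 < φ i) (hg : ∀ i ∈ s, 0 < g i) :
    (∑ i ∈ s, g i ^ 2) * Real.exp ((∑ i ∈ s, g i ^ 2 *
        (Real.log (φ i ^ 2 * ∑ j ∈ s, g j ^ 2) - Real.log (g i ^ 2))) / ∑ j ∈ s, g j ^ 2) ≤
      (∑ i ∈ s, φ i * g i) ^ 2 := by
  set S := ∑ j ∈ s, g j ^ 2 with hS
  have hSpos : 0 < S := Finset.sum_pos (fun i hi => pow_pos (hg i hi) 2) hs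
  have hS0 : S ≠ 0 := hSpos.ne'
  have hsqSpos : 0 < Real.sqrt S := Real.sqrt_pos.2 hSpos
  have hsqS : Real.sqrt S ^ 2 = S := Real.sq_sqrt hSpos.le
  have hw : ∀ i ∈ s, 0 ≤ g i ^ 2 / S := fun i hi => (div_pos (pow_pos (hg i hi) 2) hSpos).le
  have hw1 : ∑ i ∈ s, g i ^ 2 / S = 1 := by rw [← Finset.sum_div, div_self hS0]
  have hJ := SoloInformed.exp_sum_mul_le_sum_mul_exp s (fun i => g i ^ 2 / S)
    (fun i => Real.log (φ i * Real.sqrt S / g i)) hw hw1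
  -- the right-hand side of Jensen is `(∑ φ g) / √S`
  have hR : ∑ i ∈ s, g i ^ 2 / S * Real.exp (Real.log (φ i * Real.sqrt S / g i)) =
      (∑ i ∈ s, φ i * g i) / Real.sqrt S := by
    rw [Finset.sum_div]
    refine Finset.sum_congr rfl fun i hi => ?_
    have hq : 0 < φ i * Real.sqrt S / g i := div_pos (mul_pos (hφ i hi) hsqSpos) (hg i hi)
    rw [Real.exp_log hq, div_mul_div_comm,
      div_eq_div_iff (mul_ne_zero hS0 (hg i hi).ne') hsqSpos.ne']
    have hss : Real.sqrt S * Real.sqrt S = S := Real.mul_self_sqrt hSpos.le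
    calc g i ^ 2 * (φ i * Real.sqrt S) * Real.sqrt S
        = g i ^ 2 * φ i * (Real.sqrt S * Real.sqrt S) := by ring
      _ = φ i * g i * (S * g i) := by rw [hss]; ring
  -- the exponent on the left is half the normalised entropy sum
  have hL : ∑ i ∈ s, g i ^ 2 / S * Real.log (φ i * Real.sqrt S / g i) =
      (1 / 2) * ((∑ i ∈ s, g i ^ 2 *
        (Real.log (φ i ^ 2 * S) - Real.log (g i ^ 2))) / S) := by
    rw [Finset.sum_div, Finset.mul_sum]
    refine Finset.sum_congr rfl fun i hi => ?_
    have h1 : Real.log (φ i * Real.sqrt S / g i) =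
        (1 / 2) * (Real.log (φ i ^ 2 * S) - Real.log (g i ^ 2)) := by
      rw [Real.log_div (mul_pos (hφ i hi) hsqSpos).ne' (hg i hi).ne',
        Real.log_mul (hφ i hi).ne' hsqSpos.ne', Real.log_sqrt hSpos.le,
        Real.log_mul (pow_pos (hφ i hi) 2).ne' hS0, Real.log_pow, Real.log_pow]
      push_cast
      ring
    rw [h1]
    ring
  rw [hR, hL] at hJ
  have hsq := pow_le_pow_left₀ (Real.exp_pos _).le hJ 2
  rw [← Real.exp_nat_mul, div_pow, hsqS] at hsq
  push_cast at hsq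
  have hE : (2 : ℝ) * (1 / 2 * ((∑ i ∈ s, g i ^ 2 *
      (Real.log (φ i ^ 2 * S) - Real.log (g i ^ 2))) / S)) =
      (∑ i ∈ s, g i ^ 2 * (Real.log (φ i ^ 2 * S) - Real.log (g i ^ 2))) / S := by ring
  rw [hE] at hsq
  calc S * Real.exp ((∑ i ∈ s, g i ^ 2 *
        (Real.log (φ i ^ 2 * S) - Real.log (g i ^ 2))) / S)
      ≤ S * ((∑ i ∈ s, φ i * g i) ^ 2 / S) := mul_le_mul_of_nonneg_left hsq hSpos.le
    _ = (∑ i ∈ s, φ i * g i) ^ 2 := by rw [mul_div_assoc', mul_div_cancel_left₀ _ hS0]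

end Slice

section Config

variable {T : Type*} [Fintype T] [Nonempty T] {n : ℕ}

/-- Bookkeeping for a configuration function with positive slices: the normalisation
`Z = ∑ Ψ²` is positive, the one-particle density `η` is positive and sums to `1`, and
`∑_Y Ψ(x,Y)² = η(x) Z`. -/
theorem SoloInformed.density_pos_and_sum_eq_one
    (Ψ : (Fin (n + 1) → T) → ℝ) (hg : ∀ (x : T) (Y : Fin n → T), 0 < Ψ (Matrix.vecCons x Y))
    (η : T → ℝ) (hη : ∀ x, η x = (∑ Y : Fin n → T, Ψ (Matrix.vecCons x Y) ^ 2) / ∑ X, Ψ X ^ 2) :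
    (0 < ∑ X, Ψ X ^ 2) ∧ (∀ x, 0 < η x) ∧ (∑ x, η x = 1) ∧
      ∀ x, ∑ Y : Fin n → T, Ψ (Matrix.vecCons x Y) ^ 2 = η x * ∑ X, Ψ X ^ 2 := by
  have hZ' : ∑ X, Ψ X ^ 2 = ∑ x, ∑ Y : Fin n → T, Ψ (Matrix.vecCons x Y) ^ 2 :=
    SoloInformed.sum_config_eq_sum_vecCons fun X => Ψ X ^ 2
  have hZpos : 0 < ∑ X, Ψ X ^ 2 := by
    rw [hZ']
    exact Finset.sum_pos (fun x _ => Finset.sum_pos (fun Y _ => pow_pos (hg x Y) 2)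
      Finset.univ_nonempty) Finset.univ_nonempty
  have hηpos : ∀ x, 0 < η x := fun x => by
    rw [hη]
    exact div_pos (Finset.sum_pos (fun Y _ => pow_pos (hg x Y) 2) Finset.univ_nonempty) hZpos
  have hmarg : ∀ x, ∑ Y : Fin n → T, Ψ (Matrix.vecCons x Y) ^ 2 = η x * ∑ X, Ψ X ^ 2 :=
    fun x => by rw [hη, div_mul_cancel₀ _ hZpos.ne']
  refine ⟨hZpos, hηpos, ?_, hmarg⟩
  have h1 : (∑ x, η x) * ∑ X, Ψ X ^ 2 = 1 * ∑ X, Ψ X ^ 2 := by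
    rw [Finset.sum_mul, one_mul]
    calc ∑ x, η x * ∑ X, Ψ X ^ 2 = ∑ x, ∑ Y : Fin n → T, Ψ (Matrix.vecCons x Y) ^ 2 :=
          Finset.sum_congr rfl fun x _ => (hmarg x).symm
      _ = ∑ X, Ψ X ^ 2 := hZ'.symm
  exact mul_right_cancel₀ hZpos.ne' h1

/-- **Entropic Penrose–Onsager bound, general reference mode** (soloist report §3, Theorem A,
finite form). For `Ψ` with positive slices on `T^{n+1}` and any `φ > 0`: if
`∑_Y ∑ₓ Ψ(x,Y)² (log Ψ(x,Y)² - log(φ(x)² S_Y)) ≤ c · Z` — for `∑ φ² = 1` the left side is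
`Z · E_P KL(p_Y ‖ φ²)`, the mean relative entropy of the conditional one-particle law with
respect to `φ²` — then `∑_Y (∑ₓ φ(x) Ψ(x,Y))² ≥ e^{-c} Z`, i.e. `⟨φ, γ_Ψ φ⟩ ≥ e^{-c} N` for
symmetric `Ψ`. Proof: Jensen in `x` (`SoloInformed.mul_exp_sum_log_le_sq_sum_mul`), then Jensen
in `Y` with weights `P(Y) = S_Y/Z`. -/
theorem SoloInformed.occupation_ge_exp_neg_meanKL
    (Ψ : (Fin (n + 1) → T) → ℝ) (hg : ∀ (x : T) (Y : Fin n → T), 0 < Ψ (Matrix.vecCons x Y))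
    (φ : T → ℝ) (hφ : ∀ x, 0 < φ x) {c : ℝ}
    (hI : ∑ Y : Fin n → T, ∑ x, Ψ (Matrix.vecCons x Y) ^ 2 *
        (Real.log (Ψ (Matrix.vecCons x Y) ^ 2) -
          Real.log (φ x ^ 2 * ∑ x', Ψ (Matrix.vecCons x' Y) ^ 2)) ≤ c * ∑ X, Ψ X ^ 2) :
    Real.exp (-c) * ∑ X, Ψ X ^ 2 ≤
      ∑ Y : Fin n → T, (∑ x, φ x * Ψ (Matrix.vecCons x Y)) ^ 2 := by
  have hsplit : ∀ Φ : (Fin (n + 1) → T) → ℝ,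
      ∑ X, Φ X = ∑ x, ∑ Y, Φ (Matrix.vecCons x Y) := SoloInformed.sum_config_eq_sum_vecCons
  obtain ⟨Z, hZ⟩ : ∃ r : ℝ, r = ∑ X, Ψ X ^ 2 := ⟨_, rfl⟩
  rw [← hZ] at hI ⊢
  obtain ⟨S, hS⟩ : ∃ f : (Fin n → T) → ℝ, f = fun Y => ∑ x, Ψ (Matrix.vecCons x Y) ^ 2 :=
    ⟨_, rfl⟩
  obtain ⟨D, hD⟩ : ∃ f : (Fin n → T) → ℝ, f = fun Y => ∑ x, Ψ (Matrix.vecCons x Y) ^ 2 *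
      (Real.log (φ x ^ 2 * ∑ x', Ψ (Matrix.vecCons x' Y) ^ 2) -
        Real.log (Ψ (Matrix.vecCons x Y) ^ 2)) := ⟨_, rfl⟩
  have hSpos : ∀ Y, 0 < S Y := fun Y => by
    rw [hS]; exact Finset.sum_pos (fun x _ => pow_pos (hg x Y) 2) Finset.univ_nonempty
  have hZS : Z = ∑ Y, S Y := by
    rw [hZ, hsplit (fun X => Ψ X ^ 2), hS]; exact Finset.sum_comm
  have hZpos : 0 < Z := by
    rw [hZS]; exact Finset.sum_pos (fun Y _ => hSpos Y) Finset.univ_nonempty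
  have hZ0 : Z ≠ 0 := hZpos.ne'
  -- slice inequality
  have hslice : ∀ Y, S Y * Real.exp (D Y / S Y) ≤ (∑ x, φ x * Ψ (Matrix.vecCons x Y)) ^ 2 := by
    intro Y
    have h1 := SoloInformed.mul_exp_sum_log_le_sq_sum_mul Finset.univ Finset.univ_nonempty φ
      (fun x => Ψ (Matrix.vecCons x Y)) (fun x _ => hφ x) (fun x _ => hg x Y)
    rw [hS, hD]
    exact h1
  -- the hypothesis says `∑_Y D_Y ≥ -c Z`
  have hDsum : -(c * Z) ≤ ∑ Y, D Y := by
    have h1 : ∑ Y, D Y = -(∑ Y : Fin n → T, ∑ x, Ψ (Matrix.vecCons x Y) ^ 2 *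
        (Real.log (Ψ (Matrix.vecCons x Y) ^ 2) -
          Real.log (φ x ^ 2 * ∑ x', Ψ (Matrix.vecCons x' Y) ^ 2))) := by
      rw [hD, ← Finset.sum_neg_distrib]
      refine Finset.sum_congr rfl fun Y _ => ?_
      rw [← Finset.sum_neg_distrib]
      refine Finset.sum_congr rfl fun x _ => ?_
      ring
    rw [h1]
    linarith
  -- Jensen over the environment with weights `S_Y / Z`
  have hw1 : ∑ Y, S Y / Z = 1 := by rw [← Finset.sum_div, ← hZS, div_self hZ0]
  have hjen := SoloInformed.exp_sum_mul_le_sum_mul_exp Finset.univ (fun Y => S Y / Z)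
    (fun Y => D Y / S Y) (fun Y _ => (div_pos (hSpos Y) hZpos).le) hw1
  have hexponent : -c ≤ ∑ Y, S Y / Z * (D Y / S Y) := by
    have h1 : ∑ Y, S Y / Z * (D Y / S Y) = (∑ Y, D Y) / Z := by
      rw [Finset.sum_div]
      refine Finset.sum_congr rfl fun Y _ => ?_
      rw [div_mul_div_comm, mul_comm (S Y) (D Y), mul_div_mul_right _ _ (hSpos Y).ne']
    rw [h1, le_div_iff₀ hZpos]
    linarith
  calc Real.exp (-c) * Z ≤ Real.exp (∑ Y, S Y / Z * (D Y / S Y)) * Z :=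
        mul_le_mul_of_nonneg_right (Real.exp_le_exp.2 hexponent) hZpos.le
    _ ≤ (∑ Y, S Y / Z * Real.exp (D Y / S Y)) * Z := mul_le_mul_of_nonneg_right hjen hZpos.le
    _ = ∑ Y, S Y * Real.exp (D Y / S Y) := by
        rw [Finset.sum_mul]
        refine Finset.sum_congr rfl fun Y _ => ?_
        rw [mul_right_comm, div_mul_cancel₀ _ hZ0]
    _ ≤ ∑ Y, (∑ x, φ x * Ψ (Matrix.vecCons x Y)) ^ 2 := Finset.sum_le_sum fun Y _ => hslice Y

/-- **Condensate fraction ≥ e^{-(mutual information)}** (soloist report §3, Theorem A, optimal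
mode). With `η` the one-particle density of `Ψ²` and `φ = √η`: if
`∑_Y ∑ₓ Ψ(x,Y)² (log Ψ(x,Y)² - log(η(x) S_Y)) ≤ c · Z` — the left side is `Z · I(X₀ ; X̂)`,
`I` the mutual information between the first particle and the others under the law `Ψ²/Z`
[cite: CoverThomas2005, §2.3–2.4] — then `∑_Y (∑ₓ √η(x) Ψ(x,Y))² ≥ e^{-c} Z`, i.e.
`⟨√η, γ_Ψ √η⟩ / N ≥ e^{-I(X₀;X̂)}` for symmetric `Ψ`. The reference `η` is optimal:
`E_P KL(p_Y ‖ φ²) = I + KL(η ‖ φ²)`. -/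
theorem SoloInformed.sqrtDensity_occupation_ge_exp_neg_mutualInfo
    (Ψ : (Fin (n + 1) → T) → ℝ) (hg : ∀ (x : T) (Y : Fin n → T), 0 < Ψ (Matrix.vecCons x Y))
    (η : T → ℝ) (hη : ∀ x, η x = (∑ Y : Fin n → T, Ψ (Matrix.vecCons x Y) ^ 2) / ∑ X, Ψ X ^ 2)
    {c : ℝ}
    (hI : ∑ Y : Fin n → T, ∑ x, Ψ (Matrix.vecCons x Y) ^ 2 *
        (Real.log (Ψ (Matrix.vecCons x Y) ^ 2) -
          Real.log (η x * ∑ x', Ψ (Matrix.vecCons x' Y) ^ 2)) ≤ c * ∑ X, Ψ X ^ 2) :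
    Real.exp (-c) * ∑ X, Ψ X ^ 2 ≤
      ∑ Y : Fin n → T, (∑ x, Real.sqrt (η x) * Ψ (Matrix.vecCons x Y)) ^ 2 := by
  obtain ⟨-, hηpos, -, -⟩ := SoloInformed.density_pos_and_sum_eq_one Ψ hg η hη
  refine SoloInformed.occupation_ge_exp_neg_meanKL Ψ hg (fun x => Real.sqrt (η x))
    (fun x => Real.sqrt_pos.2 (hηpos x)) ?_
  have h1 : ∀ x, Real.sqrt (η x) ^ 2 = η x := fun x => Real.sq_sqrt (hηpos x).le
  simp only [h1]
  exact hI

/-- **Condensate fraction ≥ e^{-½ (mean Jeffreys divergence)}** (soloist report §3, Theorem A,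
symmetrised form; the abstract statement behind `SoloInformed.sqrtDensity_occupation_ge_of_posDef`).
With `η` the one-particle density of `Ψ²`: if the normalisation-free Jeffreys sum obeys
`∑_Y ∑ₓ (η(x) S_Y - Ψ(x,Y)²)(log η(x) - log Ψ(x,Y)²) ≤ c · Z` — the left side is
`Z · E_P J(η, p_Y)`, `J = KL(η‖p) + KL(p‖η)`, equivalently `Z · T[W]` with
`T[W] = E_P (E_η - E_{p_Y})(-log Ψ(·,Y)²)` — then `∑_Y (∑ₓ √η(x) Ψ(x,Y))² ≥ e^{-c/2} Z`, i.e.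
`⟨√η, γ_Ψ √η⟩ / N ≥ e^{-T/2}` for symmetric `Ψ`. -/
theorem SoloInformed.sqrtDensity_occupation_ge_of_sum_jeffreys_le
    (Ψ : (Fin (n + 1) → T) → ℝ) (hg : ∀ (x : T) (Y : Fin n → T), 0 < Ψ (Matrix.vecCons x Y))
    (η : T → ℝ) (hη : ∀ x, η x = (∑ Y : Fin n → T, Ψ (Matrix.vecCons x Y) ^ 2) / ∑ X, Ψ X ^ 2)
    {c : ℝ}
    (hJ : ∑ Y : Fin n → T, ∑ x, (η x * (∑ x', Ψ (Matrix.vecCons x' Y) ^ 2) -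
        Ψ (Matrix.vecCons x Y) ^ 2) * (Real.log (η x) - Real.log (Ψ (Matrix.vecCons x Y) ^ 2)) ≤
      c * ∑ X, Ψ X ^ 2) :
    Real.exp (-(c / 2)) * ∑ X, Ψ X ^ 2 ≤
      ∑ Y : Fin n → T, (∑ x, Real.sqrt (η x) * Ψ (Matrix.vecCons x Y)) ^ 2 := by
  obtain ⟨hZpos, hηpos, hη1, -⟩ := SoloInformed.density_pos_and_sum_eq_one Ψ hg η hη
  have hsplit : ∀ Φ : (Fin (n + 1) → T) → ℝ,
      ∑ X, Φ X = ∑ x, ∑ Y, Φ (Matrix.vecCons x Y) := SoloInformed.sum_config_eq_sum_vecCons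
  obtain ⟨Z, hZ⟩ : ∃ r : ℝ, r = ∑ X, Ψ X ^ 2 := ⟨_, rfl⟩
  rw [← hZ] at hJ hZpos ⊢
  have hZ0 : Z ≠ 0 := hZpos.ne'
  obtain ⟨S, hS⟩ : ∃ f : (Fin n → T) → ℝ, f = fun Y => ∑ x, Ψ (Matrix.vecCons x Y) ^ 2 :=
    ⟨_, rfl⟩
  obtain ⟨J, hJ'⟩ : ∃ f : (Fin n → T) → ℝ, f = fun Y => ∑ x, (η x * (∑ x', Ψ (Matrix.vecCons x' Y) ^ 2) -
      Ψ (Matrix.vecCons x Y) ^ 2) * (Real.log (η x) - Real.log (Ψ (Matrix.vecCons x Y) ^ 2)) :=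
    ⟨_, rfl⟩
  have hSpos : ∀ Y, 0 < S Y := fun Y => by
    rw [hS]; exact Finset.sum_pos (fun x _ => pow_pos (hg x Y) 2) Finset.univ_nonempty
  have hZS : Z = ∑ Y, S Y := by
    rw [hZ, hsplit (fun X => Ψ X ^ 2), hS]; exact Finset.sum_comm
  have hslice : ∀ Y : Fin n → T, S Y * Real.exp (-(1 / 2) * (J Y / S Y)) ≤
      (∑ x, Real.sqrt (η x) * Ψ (Matrix.vecCons x Y)) ^ 2 := by
    intro Y
    have h1 := SoloInformed.sq_sum_sqrt_mul_ge_exp_jeffreys Finset.univ η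
      (fun x => Ψ (Matrix.vecCons x Y)) (fun x _ => hηpos x) (fun x _ => hg x Y) hη1
    rw [hS, hJ']
    exact h1
  have hQ : ∑ Y, J Y ≤ c * Z := by rw [hJ']; exact hJ
  -- Jensen over the environment with weights `S_Y / Z`
  have hw1 : ∑ Y, S Y / Z = 1 := by rw [← Finset.sum_div, ← hZS, div_self hZ0]
  have hjen := SoloInformed.exp_sum_mul_le_sum_mul_exp Finset.univ (fun Y => S Y / Z)
    (fun Y => -(1 / 2) * (J Y / S Y)) (fun Y _ => (div_pos (hSpos Y) hZpos).le) hw1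
  have hexponent : -(c / 2) ≤ ∑ Y, S Y / Z * (-(1 / 2) * (J Y / S Y)) := by
    have h1 : ∑ Y, S Y / Z * (-(1 / 2) * (J Y / S Y)) = -(1 / 2) * ((∑ Y, J Y) / Z) := by
      rw [Finset.sum_div, Finset.mul_sum]
      refine Finset.sum_congr rfl fun Y _ => ?_
      rw [mul_left_comm, div_mul_div_comm, mul_comm (S Y) (J Y),
        mul_div_mul_right _ _ (hSpos Y).ne']
    have h2 : (∑ Y, J Y) / Z ≤ c := by rw [div_le_iff₀ hZpos]; exact hQ
    rw [h1]
    linarith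
  calc Real.exp (-(c / 2)) * Z ≤ Real.exp (∑ Y, S Y / Z * (-(1 / 2) * (J Y / S Y))) * Z :=
        mul_le_mul_of_nonneg_right (Real.exp_le_exp.2 hexponent) hZpos.le
    _ ≤ (∑ Y, S Y / Z * Real.exp (-(1 / 2) * (J Y / S Y))) * Z :=
        mul_le_mul_of_nonneg_right hjen hZpos.le
    _ = ∑ Y, S Y * Real.exp (-(1 / 2) * (J Y / S Y)) := by
        rw [Finset.sum_mul]
        refine Finset.sum_congr rfl fun Y _ => ?_
        rw [mul_right_comm, div_mul_cancel₀ _ hZ0]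
    _ ≤ ∑ Y : Fin n → T, (∑ x, Real.sqrt (η x) * Ψ (Matrix.vecCons x Y)) ^ 2 :=
        Finset.sum_le_sum fun Y _ => hslice Y

/-- **`I ≤ T`** (Gibbs' inequality, slice by slice): the mutual-information sum is at most the
Jeffreys sum, the difference being `∑_Y S_Y · KL(η ‖ p_Y) ≥ 0`. Hence the hypothesis of
`SoloInformed.sqrtDensity_occupation_ge_exp_neg_mutualInfo` is implied by that of
`SoloInformed.sqrtDensity_occupation_ge_of_sum_jeffreys_le` with the same constant (and the two
conclusions, `e^{-I}` and `e^{-T/2}`, are not comparable in general). -/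
theorem SoloInformed.sum_kl_le_sum_jeffreys
    (Ψ : (Fin (n + 1) → T) → ℝ) (hg : ∀ (x : T) (Y : Fin n → T), 0 < Ψ (Matrix.vecCons x Y))
    (η : T → ℝ) (hη : ∀ x, η x = (∑ Y : Fin n → T, Ψ (Matrix.vecCons x Y) ^ 2) / ∑ X, Ψ X ^ 2) :
    ∑ Y : Fin n → T, ∑ x, Ψ (Matrix.vecCons x Y) ^ 2 *
        (Real.log (Ψ (Matrix.vecCons x Y) ^ 2) -
          Real.log (η x * ∑ x', Ψ (Matrix.vecCons x' Y) ^ 2)) ≤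
      ∑ Y : Fin n → T, ∑ x, (η x * (∑ x', Ψ (Matrix.vecCons x' Y) ^ 2) -
        Ψ (Matrix.vecCons x Y) ^ 2) * (Real.log (η x) - Real.log (Ψ (Matrix.vecCons x Y) ^ 2)) := by
  obtain ⟨-, hηpos, hη1, -⟩ := SoloInformed.density_pos_and_sum_eq_one Ψ hg η hη
  refine Finset.sum_le_sum fun Y _ => ?_
  obtain ⟨S, hS⟩ : ∃ r : ℝ, r = ∑ x', Ψ (Matrix.vecCons x' Y) ^ 2 := ⟨_, rfl⟩
  rw [← hS]
  have hSpos : 0 < S := by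
    rw [hS]; exact Finset.sum_pos (fun x _ => pow_pos (hg x Y) 2) Finset.univ_nonempty
  have hS0 : S ≠ 0 := hSpos.ne'
  -- Gibbs: `η(x) - p(x) ≤ η(x) (log η(x) - log Ψ(x,Y)² + log S)` pointwise, from `log t ≤ t - 1`
  have hG : ∀ x, η x - Ψ (Matrix.vecCons x Y) ^ 2 / S ≤
      η x * (Real.log (η x) - Real.log (Ψ (Matrix.vecCons x Y) ^ 2) + Real.log S) := by
    intro x
    have hgx : 0 < Ψ (Matrix.vecCons x Y) ^ 2 := pow_pos (hg x Y) 2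
    have hq : 0 < Ψ (Matrix.vecCons x Y) ^ 2 / S / η x := div_pos (div_pos hgx hSpos) (hηpos x)
    have h1 := Real.log_le_sub_one_of_pos hq
    rw [Real.log_div (div_pos hgx hSpos).ne' (hηpos x).ne', Real.log_div hgx.ne' hS0] at h1
    have h3 := mul_le_mul_of_nonneg_left h1 (hηpos x).le
    have h4 : η x * (Ψ (Matrix.vecCons x Y) ^ 2 / S / η x - 1) =
        Ψ (Matrix.vecCons x Y) ^ 2 / S - η x := by
      rw [mul_sub, mul_one, ← mul_div_assoc, mul_div_cancel_left₀ _ (hηpos x).ne']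
    rw [h4] at h3
    linarith
  have hGsum : 0 ≤ ∑ x, η x * (Real.log (η x) - Real.log (Ψ (Matrix.vecCons x Y) ^ 2) +
      Real.log S) := by
    have h1 : ∑ x, (η x - Ψ (Matrix.vecCons x Y) ^ 2 / S) = 0 := by
      rw [Finset.sum_sub_distrib, hη1, ← Finset.sum_div, ← hS, div_self hS0, sub_self]
    calc (0 : ℝ) = ∑ x, (η x - Ψ (Matrix.vecCons x Y) ^ 2 / S) := h1.symm
      _ ≤ _ := Finset.sum_le_sum fun x _ => hG x
  -- the difference of the two slice sums is `S` times the Gibbs sum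
  have hdiff : ∑ x, (η x * S - Ψ (Matrix.vecCons x Y) ^ 2) *
      (Real.log (η x) - Real.log (Ψ (Matrix.vecCons x Y) ^ 2)) -
      ∑ x, Ψ (Matrix.vecCons x Y) ^ 2 *
        (Real.log (Ψ (Matrix.vecCons x Y) ^ 2) - Real.log (η x * S)) =
      S * ∑ x, η x * (Real.log (η x) - Real.log (Ψ (Matrix.vecCons x Y) ^ 2) + Real.log S) := by
    have h1 : ∀ x, (η x * S - Ψ (Matrix.vecCons x Y) ^ 2) *
        (Real.log (η x) - Real.log (Ψ (Matrix.vecCons x Y) ^ 2)) -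
        Ψ (Matrix.vecCons x Y) ^ 2 *
          (Real.log (Ψ (Matrix.vecCons x Y) ^ 2) - Real.log (η x * S)) =
        S * (η x * (Real.log (η x) - Real.log (Ψ (Matrix.vecCons x Y) ^ 2))) +
          Ψ (Matrix.vecCons x Y) ^ 2 * Real.log S := by
      intro x
      rw [Real.log_mul (hηpos x).ne' hS0]
      ring
    rw [← Finset.sum_sub_distrib, Finset.sum_congr rfl fun x _ => h1 x, Finset.sum_add_distrib,
      ← Finset.mul_sum, ← Finset.sum_mul, ← hS]
    have h2 : ∑ x, η x * (Real.log (η x) - Real.log (Ψ (Matrix.vecCons x Y) ^ 2) + Real.log S) =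
        ∑ x, η x * (Real.log (η x) - Real.log (Ψ (Matrix.vecCons x Y) ^ 2)) + Real.log S := by
      have h3 : ∀ x, η x * (Real.log (η x) - Real.log (Ψ (Matrix.vecCons x Y) ^ 2) + Real.log S) =
          η x * (Real.log (η x) - Real.log (Ψ (Matrix.vecCons x Y) ^ 2)) + η x * Real.log S :=
        fun x => by ring
      rw [Finset.sum_congr rfl fun x _ => h3 x, Finset.sum_add_distrib, ← Finset.sum_mul, hη1,
        one_mul]
    rw [h2]
    ring
  rw [← sub_nonneg, hdiff]
  exact mul_nonneg hSpos.le hGsum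

end Config

end Summit.AtomisticToContinuum.BoseEinsteinCondensation.Theorems

end
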